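import Mathlib
import HarnessLib
import Summits.AtomisticToContinuum.HydrodynamicLimit.Theorems.RelayRaceLocalityConeLocalisationDefs
import Summits.AtomisticToContinuum.HydrodynamicLimit.Theorems.RelayRaceLocalityConeLocalisationLocalDefs
import Summits.AtomisticToContinuum.HydrodynamicLimit.Theorems.RelayRaceLocalityConeLocalisationConeTransfer
import Summits.AtomisticToContinuum.HydrodynamicLimit.Theorems.RelayRaceLocalityLightConeInLawStubTimeZero
import Summits.AtomisticToContinuum.HydrodynamicLimit.Theorems.RelayRaceLocalityLightConeInLawCone
import Literature.MathematicalPhysics.KineticTheory.HardSphereCanonicalTorus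
import Literature.MathematicalPhysics.KineticTheory.HardSphereEulerSolutionGluing
import Literature.Analysis.FluidPDE.HardSphereAlexander

/-!
# RelayRaceLocality · ConeLocalisation — the CONE STEP `stub_coneStep`

Support file for the crux item `stmt-AtomisticToContinuum-12504` (`ConeLocalisation`, route
RelayRaceLocality of `AtomisticToContinuum/HydrodynamicLimit`), line `zoomed-bubble-transplant`,
registered stub `stub_coneStep` of the skeleton `Cruxes/ConeLocalisation/Lines/Sketch.lean`:
`PerCentreComparison → LightConeInLaw → NearConstantShortTimeHL → LocalFlooredLLN`.
Given the comparison gases packaged by `PerCentreComparison` (`…ConeLocalisationLocalDefs`),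
the light cone in law `A` and the near-constant short-time limit `B`, the LOCAL floored law of
large numbers (`…ConeLocalisationDefs`) follows by bookkeeping over the tree:

* helpers: `coneStep_exists_pos_forall_le` (positive lower bound of finitely many positive
  reals — the threshold `σ₀` is a finite minimum over the centres),
  `coneStep_tendsto_ceil_mul_hsDiameter` (the family `n₂ N = ⌈(σ₂/σ₁)³(N+1)⌉₊` has `n₂ ε³ → σ₂³`),
  `coneStep_targets_eq` (reduced data agreeing on `{χ ≠ 0}` have equal reduced targets),
  `coneStep_lln_of_merging` (THE TRANSFER at time `t`: bounded-Lipschitz merging of the reduced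
  triples + LLN of gas 2 at `t` + agreement on `{χ ≠ 0}` ⇒ LLN of gas 1 at `t` for `χ`, by
  `relayRaceLocality_coneTransfer` on `ℝ × V3 × ℝ` with thresholds `σ³δ`);
* constants: `η₀ := min (η₀ᴬ, η₀ᴮ, η₂ᴰ, ηP)`; at level `M`, `PerCentreComparison` gives
  `M′ ≥ M`, `Λ ≥ 1`; `A`, `DoD.reducedConeUniqueness` and `B` at level `M′` give `c_A`, `c_D`,
  `δ₀`, `τ₀`; `PerCentreComparison` at `δ₀` gives the agreement radius `r` and the life span
  `Tc`; `τ₁ := min τ₀ (min (Tc/2) (r/(4 max c_A c_D)))`, output radius `r/2`;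
  `σ₀ := min (1/4) (min (η₀/(M′Λ³)) s)`, `s ≤ min (σP c) (σ_A c/Λ) (σ_B c/Λ)` for `c ∈ C`;
* per `(σ, solution, Φ, t, χ ⊂ B(c, r/2), δ)`: the time-`0` slices are smooth floored-guarded
  data tied to the local Gibbs laws (the LLN hypothesis itself), so `PerCentreComparison` yields
  `σ₂ ≤ Λσ`, a classical solution `(R₂, U₂, Θ₂)` on `[0, Tc)` agreeing with the data on
  `B(c, r)` in reduced units, `δ₀`-near-constant, `C¹`-guarded by `M′`, with probability and
  time-`0` LLN of its canonical laws along the commensurate family (flows by Alexander's theorem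
  `HardSphereFlow.nonempty_torus_holds`); `B` for gas 2 gives its LLN at time `t`; `A` for the
  pair on `B(c, r)` gives merging for `χ` (vanishing off `B(c, r − c_A t) ⊇ B(c, r/2)`); the
  domain of dependence identifies the reduced fields at `t` on `B(c, r − c_D t) ⊇ {χ ≠ 0}`;
  `coneStep_lln_of_merging` transfers the LLN to gas 1.
-/

noncomputable section

namespace Summit.AtomisticToContinuum.HydrodynamicLimit.Theorems.ConeLocalisation

open scoped Topology
open Filter Set MeasureTheory
open Literature.MathematicalPhysics.KineticTheory Literature.Analysis.FluidPDE
  Literature.Analysis.FunctionSpaces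
open Summit.AtomisticToContinuum.HydrodynamicLimit.Theses.RelayRaceLocality
open Summit.AtomisticToContinuum.HydrodynamicLimit.Theorems.LightConeInLawSketch

/-! ### Helper lemmas -/

/-- **A positive lower bound of finitely many positive reals**: for `f > 0` and a finite set `C`
there is `s > 0` with `s ≤ f c` for every `c ∈ C` (`s = 1` if `C = ∅`). [folklore] -/
theorem coneStep_exists_pos_forall_le {α : Type*} (C : Finset α) (f : α → ℝ)
    (hf : ∀ c, 0 < f c) : ∃ s : ℝ, 0 < s ∧ ∀ c ∈ C, s ≤ f c := by
  classical
  induction C using Finset.induction_on with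
  | empty => exact ⟨1, one_pos, by simp⟩
  | insert a s ha ih =>
    obtain ⟨s₀, hs₀, h⟩ := ih
    refine ⟨min (f a) s₀, lt_min (hf a) hs₀, fun c hc => ?_⟩
    rcases Finset.mem_insert.1 hc with rfl | hc
    · exact min_le_left _ _
    · exact (min_le_right _ _).trans (h c hc)

/-- **The commensurate comparison family is asymptotically of reduced diameter `σ₂`**:
`⌈(σ₂/σ₁)³ (N+1)⌉₊ · hsDiameter σ₁ N ^ 3 → σ₂³`, by the squeeze
`q σ₁³ ≤ ⌈q (N+1)⌉₊ σ₁³/(N+1) ≤ q σ₁³ + σ₁³/(N+1)` with `q = (σ₂/σ₁)³`, `q σ₁³ = σ₂³`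
(`hsDiameter_pow_three`). [folklore] -/
theorem coneStep_tendsto_ceil_mul_hsDiameter {σ₁ σ₂ : ℝ} (hσ₁ : 0 < σ₁) (hσ₂ : 0 < σ₂) :
    Tendsto (fun N : ℕ => ((⌈(σ₂ / σ₁) ^ 3 * ((N + 1 : ℕ) : ℝ)⌉₊ : ℕ) : ℝ) * hsDiameter σ₁ N ^ 3)
      atTop (𝓝 (σ₂ ^ 3)) := by
  -- adapted from `Cruxes/LightConeInLaw/Lines/SketchRestatements.lean`
  -- (`tendsto_ceil_mul_hsDiameter`, line `Sketch` of stmt-12500)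
  set q : ℝ := (σ₂ / σ₁) ^ 3 with hq
  have hq0 : 0 ≤ q := by positivity
  have hσ₁3 : σ₁ ^ 3 ≠ 0 := by positivity
  have hqσ : q * σ₁ ^ 3 = σ₂ ^ 3 := by
    rw [hq, div_pow, div_mul_cancel₀ _ hσ₁3]
  have hlow : ∀ N : ℕ, q * σ₁ ^ 3 ≤
      ((⌈q * ((N + 1 : ℕ) : ℝ)⌉₊ : ℕ) : ℝ) * hsDiameter σ₁ N ^ 3 := by
    intro N
    have hN : (0 : ℝ) < ((N + 1 : ℕ) : ℝ) := by positivity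
    rw [hsDiameter_pow_three]
    calc q * σ₁ ^ 3 = (q * ((N + 1 : ℕ) : ℝ)) * (σ₁ ^ 3 / ((N + 1 : ℕ) : ℝ)) := by
          field_simp
      _ ≤ (⌈q * ((N + 1 : ℕ) : ℝ)⌉₊ : ℝ) * (σ₁ ^ 3 / ((N + 1 : ℕ) : ℝ)) := by
          gcongr
          exact Nat.le_ceil _
  have hup : ∀ N : ℕ, ((⌈q * ((N + 1 : ℕ) : ℝ)⌉₊ : ℕ) : ℝ) * hsDiameter σ₁ N ^ 3 ≤
      q * σ₁ ^ 3 + σ₁ ^ 3 / ((N + 1 : ℕ) : ℝ) := by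
    intro N
    have hN : (0 : ℝ) < ((N + 1 : ℕ) : ℝ) := by positivity
    rw [hsDiameter_pow_three]
    have h2 : (⌈q * ((N + 1 : ℕ) : ℝ)⌉₊ : ℝ) < q * ((N + 1 : ℕ) : ℝ) + 1 :=
      Nat.ceil_lt_add_one (by positivity)
    calc (⌈q * ((N + 1 : ℕ) : ℝ)⌉₊ : ℝ) * (σ₁ ^ 3 / ((N + 1 : ℕ) : ℝ))
        ≤ (q * ((N + 1 : ℕ) : ℝ) + 1) * (σ₁ ^ 3 / ((N + 1 : ℕ) : ℝ)) := by gcongr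
      _ = q * σ₁ ^ 3 + σ₁ ^ 3 / ((N + 1 : ℕ) : ℝ) := by field_simp
  have hlim : Tendsto (fun N : ℕ => q * σ₁ ^ 3 + σ₁ ^ 3 / ((N + 1 : ℕ) : ℝ)) atTop
      (𝓝 (q * σ₁ ^ 3)) := by
    have h0 : Tendsto (fun N : ℕ => σ₁ ^ 3 / ((N + 1 : ℕ) : ℝ)) atTop (𝓝 0) :=
      (tendsto_const_div_atTop_nhds_zero_nat (σ₁ ^ 3)).comp (tendsto_add_atTop_nat 1)
    simpa using tendsto_const_nhds.add h0
  rw [← hqσ]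
  exact tendsto_of_tendsto_of_tendsto_of_le_of_le tendsto_const_nhds hlim hlow hup

/-- **Equal reduced targets.** If the reduced data `(ρσ³, U, Θ)` of two gases agree at every
point where `χ` does not vanish, the reduced deterministic targets of the three empirical fields
tested against `χ` — `(σ³ ∫χρ, σ³ • ∫(χρ)•U, σ³ ∫χE(ρ,U,Θ))` — coincide (pointwise equality of
the integrands: either `χ x = 0` or the data agree). [folklore] -/
theorem coneStep_targets_eq {σ₁ σ₂ : ℝ} {ρ₁ Θ₁ ρ₂ Θ₂ χ : T3 → ℝ} {U₁ U₂ : T3 → V3}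
    (hagree : ∀ x, χ x ≠ 0 → ρ₁ x * σ₁ ^ 3 = ρ₂ x * σ₂ ^ 3 ∧ U₁ x = U₂ x ∧ Θ₁ x = Θ₂ x) :
    ((σ₁ ^ 3 * ∫ x, χ x * ρ₁ x, (σ₁ ^ 3) • ∫ x, (χ x * ρ₁ x) • U₁ x,
        σ₁ ^ 3 * ∫ x, χ x * totalEnergyDensity (ρ₁ x) (U₁ x) (Θ₁ x)) : ℝ × V3 × ℝ) =
      (σ₂ ^ 3 * ∫ x, χ x * ρ₂ x, (σ₂ ^ 3) • ∫ x, (χ x * ρ₂ x) • U₂ x,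
        σ₂ ^ 3 * ∫ x, χ x * totalEnergyDensity (ρ₂ x) (U₂ x) (Θ₂ x)) := by
  -- adapted from `Theorems/RelayRaceLocalityLightConeInLawStubTimeZero.lean` (`stub_timeZero`)
  have hptρ : ∀ x, σ₁ ^ 3 * (χ x * ρ₁ x) = σ₂ ^ 3 * (χ x * ρ₂ x) := by
    intro x
    by_cases hx : χ x = 0
    · simp [hx]
    · have h := (hagree x hx).1
      calc σ₁ ^ 3 * (χ x * ρ₁ x) = χ x * (ρ₁ x * σ₁ ^ 3) := by ring
        _ = χ x * (ρ₂ x * σ₂ ^ 3) := by rw [h]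
        _ = σ₂ ^ 3 * (χ x * ρ₂ x) := by ring
  have hptU : ∀ x, (σ₁ ^ 3) • ((χ x * ρ₁ x) • U₁ x) = (σ₂ ^ 3) • ((χ x * ρ₂ x) • U₂ x) := by
    intro x
    by_cases hx : χ x = 0
    · simp [hx]
    · obtain ⟨-, hU, -⟩ := hagree x hx
      rw [smul_smul, smul_smul, hptρ x, hU]
  have hptE : ∀ x, σ₁ ^ 3 * (χ x * totalEnergyDensity (ρ₁ x) (U₁ x) (Θ₁ x)) =
      σ₂ ^ 3 * (χ x * totalEnergyDensity (ρ₂ x) (U₂ x) (Θ₂ x)) := by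
    intro x
    by_cases hx : χ x = 0
    · simp [hx]
    · obtain ⟨-, hU, hΘ⟩ := hagree x hx
      simp only [totalEnergyDensity]
      calc σ₁ ^ 3 * (χ x * (ρ₁ x * (‖U₁ x‖ ^ 2 / 2 + 3 / 2 * Θ₁ x)))
          = σ₁ ^ 3 * (χ x * ρ₁ x) * (‖U₁ x‖ ^ 2 / 2 + 3 / 2 * Θ₁ x) := by ring
        _ = σ₂ ^ 3 * (χ x * ρ₂ x) * (‖U₂ x‖ ^ 2 / 2 + 3 / 2 * Θ₂ x) := by rw [hptρ x, hU, hΘ]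
        _ = σ₂ ^ 3 * (χ x * (ρ₂ x * (‖U₂ x‖ ^ 2 / 2 + 3 / 2 * Θ₂ x))) := by ring
  refine Prod.ext ?_ (Prod.ext ?_ ?_)
  · change σ₁ ^ 3 * ∫ x, χ x * ρ₁ x = σ₂ ^ 3 * ∫ x, χ x * ρ₂ x
    rw [← integral_const_mul, ← integral_const_mul]
    exact integral_congr_ae (Eventually.of_forall hptρ)
  · change (σ₁ ^ 3) • ∫ x, (χ x * ρ₁ x) • U₁ x = (σ₂ ^ 3) • ∫ x, (χ x * ρ₂ x) • U₂ x
    rw [← integral_smul, ← integral_smul]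
    exact integral_congr_ae (Eventually.of_forall hptU)
  · change σ₁ ^ 3 * ∫ x, χ x * totalEnergyDensity (ρ₁ x) (U₁ x) (Θ₁ x) =
      σ₂ ^ 3 * ∫ x, χ x * totalEnergyDensity (ρ₂ x) (U₂ x) (Θ₂ x)
    rw [← integral_const_mul, ← integral_const_mul]
    exact integral_congr_ae (Eventually.of_forall hptE)

/-- **The transfer at time `t` (cone step, probabilistic half).** Two hard-sphere gases
(arbitrary particle numbers, diameters, probability laws and flows) at reduced diameters
`σ₁, σ₂ > 0`; if (i) the laws of their reduced empirical triples tested against a continuous `χ`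
merge at time `t` in the bounded-Lipschitz sense (the conclusion of `LightConeInLaw`), (ii) gas 2
satisfies the three-field law of large numbers at time `t` towards `(ρ₂, U₂, Θ₂)` (`LLNAt`, the
conclusion of `NearConstantShortTimeHL`), and (iii) the reduced data `(ρσ³, U, Θ)` of the two
limits agree wherever `χ ≠ 0` (Euler's domain of dependence), then gas 1 satisfies the
three-field law of large numbers at time `t` for `χ` towards `(ρ₁, U₁, Θ₁)`: by
`relayRaceLocality_coneTransfer` the reduced triple of gas 1 converges in probability to the
common reduced target, and each field deviation exceeds `δ` only if the sup distance of the
reduced triples exceeds `σ₁³ δ`. [folklore] -/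
theorem coneStep_lln_of_merging {n₁ n₂ : ℕ → ℕ} {ε₁ ε₂ : ℕ → ℝ} {σ₁ σ₂ : ℝ} (hσ₁ : 0 < σ₁)
    (hσ₂ : 0 < σ₂) (Φ₁ : (N : ℕ) → HardSphereFlow G3 (ε₁ N) (n₁ N))
    (Φ₂ : (N : ℕ) → HardSphereFlow G3 (ε₂ N) (n₂ N))
    (P₁ : (N : ℕ) → Measure (Config (n₁ N) (Fin 3) T3))
    (P₂ : (N : ℕ) → Measure (Config (n₂ N) (Fin 3) T3))
    (hP₁ : ∀ N, IsProbabilityMeasure (P₁ N)) (hP₂ : ∀ N, IsProbabilityMeasure (P₂ N))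
    (ρ₁ Θ₁ ρ₂ Θ₂ : T3 → ℝ) (U₁ U₂ : T3 → V3) (t : ℝ)
    (hL₂ : LLNAt n₂ P₂ Φ₂ ρ₂ U₂ Θ₂ t) {χ : T3 → ℝ} (hχ : Continuous χ)
    (hagree : ∀ x, χ x ≠ 0 → ρ₁ x * σ₁ ^ 3 = ρ₂ x * σ₂ ^ 3 ∧ U₁ x = U₂ x ∧ Θ₁ x = Θ₂ x)
    (hF : ∀ F : ℝ × V3 × ℝ → ℝ, LipschitzWith 1 F → (∀ p, |F p| ≤ 1) →
      Tendsto (fun N =>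
        (∫ z, F (σ₁ ^ 3 * empiricalDensityField ((Φ₁ N).flow t z) χ,
            (σ₁ ^ 3) • empiricalMomentumField ((Φ₁ N).flow t z) χ,
            σ₁ ^ 3 * empiricalEnergyField ((Φ₁ N).flow t z) χ) ∂(P₁ N)) -
        ∫ z, F (σ₂ ^ 3 * empiricalDensityField ((Φ₂ N).flow t z) χ,
            (σ₂ ^ 3) • empiricalMomentumField ((Φ₂ N).flow t z) χ,
            σ₂ ^ 3 * empiricalEnergyField ((Φ₂ N).flow t z) χ) ∂(P₂ N)) atTop (𝓝 0))
    (δ : ℝ) (hδ : 0 < δ) :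
    Tendsto (fun N => P₁ N {z | δ < |empiricalDensityField ((Φ₁ N).flow t z) χ -
        ∫ x, χ x * ρ₁ x|}) atTop (𝓝 0) ∧
    Tendsto (fun N => P₁ N {z | δ < ‖empiricalMomentumField ((Φ₁ N).flow t z) χ -
        ∫ x, (χ x * ρ₁ x) • U₁ x‖}) atTop (𝓝 0) ∧
    Tendsto (fun N => P₁ N {z | δ < |empiricalEnergyField ((Φ₁ N).flow t z) χ -
        ∫ x, χ x * totalEnergyDensity (ρ₁ x) (U₁ x) (Θ₁ x)|}) atTop (𝓝 0) := by
  have hv := coneStep_targets_eq hagree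
  -- gas 2: convergence in probability of the reduced triple to its reduced target
  have h₂ : ∀ δ' : ℝ, 0 < δ' → Tendsto (fun N => P₂ N {z | δ' < dist
      (σ₂ ^ 3 * empiricalDensityField ((Φ₂ N).flow t z) χ,
        (σ₂ ^ 3) • empiricalMomentumField ((Φ₂ N).flow t z) χ,
        σ₂ ^ 3 * empiricalEnergyField ((Φ₂ N).flow t z) χ)
      (σ₂ ^ 3 * ∫ x, χ x * ρ₂ x, (σ₂ ^ 3) • ∫ x, (χ x * ρ₂ x) • U₂ x,
        σ₂ ^ 3 * ∫ x, χ x * totalEnergyDensity (ρ₂ x) (U₂ x) (Θ₂ x))}) atTop (𝓝 0) :=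
    fun δ' hδ' => TimeZero.tendsto_measure_dist_reducedTriple P₂ Φ₂ ρ₂ Θ₂ U₂ t hL₂ hσ₂ hχ δ' hδ'
  -- the cone transfer: gas 1's reduced triple converges in probability to the same target
  have h₁ := relayRaceLocality_coneTransfer
    (Ω₁ := fun N => Config (n₁ N) (Fin 3) T3) (Ω₂ := fun N => Config (n₂ N) (Fin 3) T3)
    (X₁ := fun N z => (σ₁ ^ 3 * empiricalDensityField ((Φ₁ N).flow t z) χ,
      (σ₁ ^ 3) • empiricalMomentumField ((Φ₁ N).flow t z) χ,
      σ₁ ^ 3 * empiricalEnergyField ((Φ₁ N).flow t z) χ))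
    (X₂ := fun N z => (σ₂ ^ 3 * empiricalDensityField ((Φ₂ N).flow t z) χ,
      (σ₂ ^ 3) • empiricalMomentumField ((Φ₂ N).flow t z) χ,
      σ₂ ^ 3 * empiricalEnergyField ((Φ₂ N).flow t z) χ))
    P₁ P₂ (fun N => TimeZero.measurable_reducedTriple (Φ₁ N) σ₁ t hχ)
    (fun N => TimeZero.measurable_reducedTriple (Φ₂ N) σ₂ t hχ)
    (σ₂ ^ 3 * ∫ x, χ x * ρ₂ x, (σ₂ ^ 3) • ∫ x, (χ x * ρ₂ x) • U₂ x,
      σ₂ ^ 3 * ∫ x, χ x * totalEnergyDensity (ρ₂ x) (U₂ x) (Θ₂ x)) hF h₂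
  rw [← hv] at h₁
  have hσ3 : 0 < σ₁ ^ 3 := pow_pos hσ₁ 3
  have key := h₁ (σ₁ ^ 3 * δ) (mul_pos hσ3 hδ)
  refine ⟨?_, ?_, ?_⟩ <;>
    refine tendsto_of_tendsto_of_tendsto_of_le_of_le tendsto_const_nhds key
      (fun N => zero_le) fun N => measure_mono fun z hz => ?_
  · simp only [Set.mem_setOf_eq] at hz ⊢
    rw [Prod.dist_eq, lt_max_iff]
    left
    rw [Real.dist_eq, ← mul_sub, abs_mul, abs_of_pos hσ3]
    exact mul_lt_mul_of_pos_left hz hσ3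
  · simp only [Set.mem_setOf_eq] at hz ⊢
    rw [Prod.dist_eq, Prod.dist_eq, lt_max_iff, lt_max_iff]
    right; left
    rw [dist_eq_norm, ← smul_sub, norm_smul, Real.norm_eq_abs, abs_of_pos hσ3]
    exact mul_lt_mul_of_pos_left hz hσ3
  · simp only [Set.mem_setOf_eq] at hz ⊢
    rw [Prod.dist_eq, Prod.dist_eq, lt_max_iff, lt_max_iff]
    right; right
    rw [Real.dist_eq, ← mul_sub, abs_mul, abs_of_pos hσ3]
    exact mul_lt_mul_of_pos_left hz hσ3

/-! ### The stub -/

/-- **STUB `stub_coneStep` (the cone step of the line `zoomed-bubble-transplant`).** The comparison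
gases of `PerCentreComparison`, the light cone in law and the near-constant short-time hydrodynamic
limit give the local floored law of large numbers: for `t < τ₁(M)` and every continuous test function
supported in the `r(M)/2`-ball of one of finitely many centres fixed before the profile, the three
empirical fields of the conjunct's gas satisfy the law of large numbers at time `t` under the floored
`C³` guards `M` on `[0, t]`. [folklore] -/
theorem stub_coneStep : PerCentreComparison → LightConeInLaw → NearConstantShortTimeHL → LocalFlooredLLN := by
  intro hP hA hB
  obtain ⟨ηP, hηP, HP⟩ := hP
  obtain ⟨ηA, hηA, HA⟩ := hA
  obtain ⟨ηB, hηB, HB⟩ := hB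
  obtain ⟨ηD, hηD, HD⟩ := LightConeInLawSketch.DoD.reducedConeUniqueness
  -- the packing threshold of the conclusion
  have hη₀pos : 0 < min (min ηA ηB) (min ηD ηP) := lt_min (lt_min hηA hηB) (lt_min hηD hηP)
  refine ⟨min (min ηA ηB) (min ηD ηP), hη₀pos, fun M hM => ?_⟩
  set η₀ : ℝ := min (min ηA ηB) (min ηD ηP) with hη₀
  have hη₀A : η₀ ≤ ηA := (min_le_left _ _).trans (min_le_left _ _)
  have hη₀B : η₀ ≤ ηB := (min_le_left _ _).trans (min_le_right _ _)
  have hη₀D : η₀ ≤ ηD := (min_le_right _ _).trans (min_le_left _ _)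
  have hη₀P : η₀ ≤ ηP := (min_le_right _ _).trans (min_le_right _ _)
  -- the constants at guard level `M`
  obtain ⟨M', hMM', Λ, hΛ, HP1⟩ := HP M hM
  have hM' : 0 < M' := hM.trans_le hMM'
  have hΛ0 : 0 < Λ := one_pos.trans_le hΛ
  obtain ⟨cA, hcA, HA1⟩ := HA M' hM'
  obtain ⟨cD, hcD, HD1⟩ := HD M' hM'
  obtain ⟨δ₀, hδ₀, τ₀, hτ₀, HB1⟩ := HB M' hM'
  obtain ⟨r, hr, Tc, hTc, HP2⟩ := HP1 δ₀ hδ₀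
  have hcs : 0 < max cA cD := lt_max_of_lt_left hcA
  refine ⟨min τ₀ (min (Tc / 2) (r / (4 * max cA cD))),
    lt_min hτ₀ (lt_min (half_pos hTc) (div_pos hr (by positivity))), r / 2, half_pos hr,
    fun C a₀ θ₀ u₀ ha hθ hu ha0 hθ0 => ?_⟩
  -- the per-centre comparison profiles and the three families of thresholds
  choose a₂ θ₂ u₂ ha₂ hθ₂ hu₂ ha₂0 hθ₂0 σP hσP HP3 using HP2 a₀ θ₀ u₀ ha hθ hu ha0 hθ0
  choose σA hσA HA2 using fun c : T3 => HA1 a₀ θ₀ (a₂ c) (θ₂ c) u₀ (u₂ c) ha hθ hu (ha₂ c)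
    (hθ₂ c) (hu₂ c) ha0 hθ0 (ha₂0 c) (hθ₂0 c)
  choose σB hσB HB2 using fun c : T3 => HB1 (a₂ c) (θ₂ c) (u₂ c) (ha₂ c) (hθ₂ c) (hu₂ c)
    (ha₂0 c) (hθ₂0 c)
  obtain ⟨s, hs, hsC⟩ := coneStep_exists_pos_forall_le C
    (fun c => min (σP c) (min (σA c / Λ) (σB c / Λ))) fun c =>
      lt_min (hσP c) (lt_min (div_pos (hσA c) hΛ0) (div_pos (hσB c) hΛ0))
  refine ⟨min (1 / 4) (min (η₀ / (M' * Λ ^ 3)) s),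
    lt_min (by norm_num) (lt_min (div_pos hη₀pos (by positivity)) hs),
    fun σ hσ hσ₀ T ρ θ u hsol Φ hLLN0 t ht hg χ hχ hsupp δ hδ => ?_⟩
  obtain ⟨c, hcC, hχc⟩ := hsupp
  -- the reduced diameter `σ`
  have hσ4 : σ < 1 / 4 := hσ₀.trans_le (min_le_left _ _)
  have hσ2 : σ ≤ 1 / 2 := by linarith
  have hσhalf : σ < 2⁻¹ := by rw [inv_eq_one_div]; linarith
  have hση : σ < η₀ / (M' * Λ ^ 3) :=
    hσ₀.trans_le ((min_le_right _ _).trans (min_le_left _ _))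
  have hσs : σ < s := hσ₀.trans_le ((min_le_right _ _).trans (min_le_right _ _))
  have hsc := hsC c hcC
  have hσP' : σ < σP c := hσs.trans_le (hsc.trans (min_le_left _ _))
  have hσAΛ : Λ * σ < σA c := by
    have h := hσs.trans_le (hsc.trans ((min_le_right _ _).trans (min_le_left _ _)))
    rwa [lt_div_iff₀ hΛ0, mul_comm] at h
  have hσBΛ : Λ * σ < σB c := by
    have h := hσs.trans_le (hsc.trans ((min_le_right _ _).trans (min_le_right _ _)))
    rwa [lt_div_iff₀ hΛ0, mul_comm] at h
  have hσA' : σ < σA c := (le_mul_of_one_le_left hσ.le hΛ).trans_lt hσAΛ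
  have hpackσ : M' * Λ ^ 3 * σ < η₀ := by
    rwa [lt_div_iff₀ (by positivity : (0 : ℝ) < M' * Λ ^ 3), mul_comm] at hση
  have hσ31 : σ ^ 3 ≤ σ := pow_le_of_le_one hσ.le (by linarith) (by norm_num)
  -- the time `t`
  obtain ⟨ht0, htm⟩ := ht
  have htT : t < T := htm.trans_le (min_le_left _ _)
  have htτ₁ : t < min τ₀ (min (Tc / 2) (r / (4 * max cA cD))) := htm.trans_le (min_le_right _ _)
  have htτ₀ : t < τ₀ := htτ₁.trans_le (min_le_left _ _)
  have htTc2 : t < Tc / 2 := htτ₁.trans_le ((min_le_right _ _).trans (min_le_left _ _))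
  have htTc : t < Tc := by linarith
  have htr : t < r / (4 * max cA cD) :=
    htτ₁.trans_le ((min_le_right _ _).trans (min_le_right _ _))
  have hct : max cA cD * t < r / 4 := by
    rw [lt_div_iff₀ (by positivity : (0 : ℝ) < 4 * max cA cD)] at htr
    linarith
  have hcAt : cA * t ≤ r / 4 := by nlinarith [le_max_left cA cD]
  have hcDt : cD * t ≤ r / 4 := by nlinarith [le_max_right cA cD]
  have hT : 0 < T := ht0.trans_lt htT
  -- (1) the comparison gas around `c`: the time-0 slices are smooth floored-guarded tied data
  obtain ⟨hρs, hus, hθs⟩ := hsol.isSmooth_slices (t := 0) ⟨le_rfl, hT⟩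
  obtain ⟨σ₂, hσ₂, hσ₂Λ, R₂, Θ₂, U₂, hsol₂, hagree, hnear, hguard₂, HP5⟩ :=
    HP3 c σ hσ hσP' (ρ 0) (θ 0) (u 0) hρs hθs hus
      (fun x => by
        obtain ⟨h1, h2, h3, h4, h5, h6, h7⟩ := hg 0 ⟨le_rfl, ht0⟩ x
        exact ⟨(h1.trans_le hη₀P).le, h3, h2, h5, h4, h6, h7⟩)
      Φ hLLN0
  have hσ₂A : σ₂ < σA c := hσ₂Λ.trans_lt hσAΛ
  have hσ₂B : σ₂ < σB c := hσ₂Λ.trans_lt hσBΛ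
  -- packing of gas 2: `R₂ σ₂³ ≤ M′ Λ³ σ³ ≤ M′ Λ³ σ < η₀`
  have hpack₂ : ∀ s ∈ Ico (0 : ℝ) Tc, ∀ x, R₂ s x * σ₂ ^ 3 < η₀ := by
    intro s hs x
    calc R₂ s x * σ₂ ^ 3 ≤ M' * σ₂ ^ 3 :=
          mul_le_mul_of_nonneg_right (hguard₂ s hs x).1 (pow_nonneg hσ₂.le 3)
      _ ≤ M' * (Λ * σ) ^ 3 := mul_le_mul_of_nonneg_left (pow_le_pow_left₀ hσ₂.le hσ₂Λ 3) hM'.le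
      _ = M' * Λ ^ 3 * σ ^ 3 := by ring
      _ ≤ M' * Λ ^ 3 * σ := mul_le_mul_of_nonneg_left hσ31 (by positivity)
      _ < η₀ := hpackσ
  -- the joint guards of the pair (gas 1, gas 2) on `[0, t]` at level `M′`, packing `< η`
  have hgAD : ∀ η : ℝ, η₀ ≤ η → ∀ s ∈ Icc (0 : ℝ) t, ∀ x, ρ s x * σ ^ 3 < η ∧ θ s x ≤ M' ∧
      ‖u s x‖ ≤ M' ∧ R₂ s x * σ₂ ^ 3 < η ∧ Θ₂ s x ≤ M' ∧ ‖U₂ s x‖ ≤ M' := by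
    intro η hη s hs x
    obtain ⟨h1, -, -, h4, -, h6, -⟩ := hg s hs x
    have hs' : s ∈ Ico (0 : ℝ) Tc := ⟨hs.1, hs.2.trans_lt htTc⟩
    obtain ⟨-, h2', -, h4', -⟩ := hguard₂ s hs' x
    exact ⟨h1.trans_le hη, h4.trans hMM', h6.trans hMM', (hpack₂ s hs' x).trans_le hη, h2', h4'⟩
  -- (2) the flows of gas 2 (Alexander's theorem) and the time-0 statics of its canonical laws
  let n₂ : ℕ → ℕ := fun N => ⌈(σ₂ / σ) ^ 3 * ((N + 1 : ℕ) : ℝ)⌉₊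
  let Φ₂ : (N : ℕ) → HardSphereFlow G3 (hsDiameter σ N) (n₂ N) := fun N =>
    (HardSphereFlow.nonempty_torus_holds (d := Fin 3) (hsDiameter_pos hσ N)
      ((hsDiameter_le hσ.le N).trans_lt hσhalf) (n₂ N)).some
  obtain ⟨hP₂prob, hLLN₂0⟩ := HP5 Φ₂
  -- (3) the commensurate family has reduced diameter `σ₂` asymptotically
  have hlim : Tendsto (fun N => (n₂ N : ℝ) * hsDiameter σ N ^ 3) atTop (𝓝 (σ₂ ^ 3)) :=
    coneStep_tendsto_ceil_mul_hsDiameter hσ hσ₂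
  -- (4) `B` for gas 2: the law of large numbers of gas 2 at time `t`
  have hLLN₂t := HB2 c σ₂ hσ₂ hσ₂B (hsDiameter σ) n₂ (fun N => hsDiameter_pos hσ N)
    (tendsto_hsDiameter σ) hlim Tc R₂ Θ₂ U₂ hsol₂ hnear Φ₂ hP₂prob hLLN₂0 t
    ⟨ht0, lt_min htTc htτ₀⟩ (fun s hs x => by
      have hs' : s ∈ Ico (0 : ℝ) Tc := ⟨hs.1, hs.2.trans_lt htTc⟩
      obtain ⟨-, h2, h3, h4, h5⟩ := hguard₂ s hs' x
      exact ⟨(hpack₂ s hs' x).trans_le hη₀B, h2, h3, h4, h5⟩)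
  -- (5) `A` for the pair on `B(c, r)`: bounded-Lipschitz merging of the reduced triples for `χ`
  have hP₁prob : ∀ N, IsProbabilityMeasure (localGibbsLaw σ a₀ u₀ θ₀ N (Φ N)) := fun N =>
    isProbabilityMeasure_localGibbsLaw ha hθ hu ha0 hθ0 hσ2 N (Φ N)
  have hmerge := HA2 c σ σ₂ hσ hσA' hσ₂ hσ₂A n₂ hlim T Tc ρ θ R₂ Θ₂ u U₂ hsol hsol₂ Φ Φ₂
    hP₁prob hP₂prob hLLN0 hLLN₂0 t ht0 htT htTc (hgAD ηA hη₀A) c r hagree χ hχ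
    (fun x hx => hχc x (by linarith))
  -- (6) Euler's domain of dependence: the reduced fields agree at time `t` where `χ ≠ 0`
  have hDoD := HD1 σ σ₂ hσ hσ₂ T Tc ρ θ R₂ Θ₂ u U₂ hsol hsol₂ t ht0 htT htTc (hgAD ηD hη₀D)
    c r hagree
  have hagree_t : ∀ x, χ x ≠ 0 →
      ρ t x * σ ^ 3 = R₂ t x * σ₂ ^ 3 ∧ u t x = U₂ t x ∧ θ t x = Θ₂ t x := by
    intro x hx
    refine hDoD x ?_
    by_contra hle
    exact hx (hχc x (by push Not at hle; linarith))
  -- (7) the transfer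
  exact coneStep_lln_of_merging hσ hσ₂ Φ Φ₂ (fun N => localGibbsLaw σ a₀ u₀ θ₀ N (Φ N))
    (fun N => particleLaw (Φ₂ N) (canonicalDensity G3 (hsDiameter σ N) (n₂ N)
      (localGibbsProfile (a₂ c) (u₂ c) (θ₂ c))))
    hP₁prob hP₂prob (ρ t) (θ t) (R₂ t) (Θ₂ t) (u t) (U₂ t) t hLLN₂t hχ hagree_t hmerge δ hδ

end Summit.AtomisticToContinuum.HydrodynamicLimit.Theorems.ConeLocalisation

end
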